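import Summits.CriticalPhenomena.PercolationContinuityZ3.Theorems.Transplant.SkelPhiConcReachHab
import Summits.CriticalPhenomena.PercolationContinuityZ3.Theorems.Transplant.SkelPhiConcHout
import Summits.CriticalPhenomena.PercolationContinuityZ3.Theorems.Transplant.SkelPhiConcExcess
import Summits.CriticalPhenomena.PercolationContinuityZ3.Theorems.Transplant.SkelPhiCellsConcGLevels
import Summits.CriticalPhenomena.PercolationContinuityZ3.Theorems.Transplant.PlanarCells2Levels
import Summits.CriticalPhenomena.PercolationContinuityZ3.Theorems.Transplant.SkelConcReachHab
import HarnessLib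

/-!
# D″ node, STRUCTURE-FREE layer L6′ (C) part 4: the RIM EXCESS of the corridor test over a planar map, in the corridor-world window graph — the
# φ-level re-cut of `SkelConcReachExcess` (`Skel.real_rim_le_concSG`, p5 gen 4) over the two-unit cells and hp-8's φ-level excess discharge
# `Skelφ.real_rim_le_of_radius_In` (DPRIME-SCOPE §2 L6′ (C); p3 addendum K; DP9/DP10 of the refuter's checklist)

builds on p205010 (kernel theorem, internal audit signed; external expert review pending) — nothing in this file uses p205010.
Lane `prim-bschramm`, seat `prim-bschramm-p5` (gen 6; (C) column, DPRIME K.4), helper file (`--supports stmt-CriticalPhenomena-4575`).  NEW FILE.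
Dictionary: `Φ ↦ (G, φ)` with `hlip` (`levelGeomSG`, `qSepGeomSG`) and `hstep` (`stepsGeomSG`) from p2-g7's `SkelPhiCellsConcGLevels`; `C : PCells ↦ P : PCells2`
(planar envelopes `Q/Hfull_subset_box_image`, `BtwN_subset_box_image_tgt` at `25·rmax`, hp-8 `PlanarCells2Levels`; the planar spread of the fresh world becomes
`box 2 (50·rmax)`); `Skel.real_rim_le_of_radius_In Φ (by convert hWD) ↦ Skelφ.real_rim_le_of_radius_In hWD` (hp-8 g30's design note: no bridge);
`KSchA.isSubbox_Wcor_graph / disjoint_Vx_of_fresh` are Φ-free (unchanged).  Proof = the source's, verbatim up to these substitutions.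

For the scheme of record `⟨Skelφ.cellGeomSG G φ P t Λ, q, δc⟩` rooted at `t`: under the corridor law `Wcor`, the probability that the root is joined to
a RIM set — a part of the fresh habitat `Skelφ.habΩ = E^{α}_{x,y} ∪ H^{a'}_{y,y+du}` lying inside the habitat proper `Q_α(y) ∪ E^far` and beyond depth
`E − L'` — is at most the uniform excess bound `η` of an excess radius `R₁ ≤ E − L'`, provided the explored neighbours of the fresh habitat are deep
(`hdeep`, supplied on runs by `Skelφ.deep_of_run`).  The exploration graph is `winGraphIn G Ucor` of the WHOLE corridor world (the Ω-route).
[cite: KozmaNitzan2024, §4 Lemma 12 (pp. 23–25), p. 30 (Step IV), p. 31]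
-/

noncomputable section

open MeasureTheory

namespace Summit.CriticalPhenomena.PercolationContinuityZ3.Theorems

namespace Transplant

namespace Skelφ

open Literature.Probability.Percolation Literature.Probability.LatticeModels SimpleGraph GadgetSystem ProbeHistory HSiteScheme Contour KNCells
open KNLevels
open Literature.Probability.Percolation.GM
open Literature.Probability.Percolation.KozmaNitzan.Cells (sgOf stepVec_apply_fst stepVec_apply_oth)
open Literature.Barriers.CriticalPhenomena (graphBall graphBall_finite mem_graphBall_self graphBall_mono)
open BoxProdZ2 (ConcRadiiG)
open Skel (excess winGraphIn winGraphIn_le winGraphIn_adj)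

open scoped Classical

variable {V : Type} [DecidableEq V] {G : SimpleGraph V} [G.LocallyFinite] {φ : V → Site 2}
variable {P : PCells2} {t : V} {Λ : ConcRadiiG}

/-- **Rim excess of the corridor test over a planar map.** Under the corridor law `Wcor` of the concentric scheme of record (root `t`, cube span
of depth `rQ = E`, incoming between-box of depth `≤ E`, staircase profile `≤ E`), if every explored neighbour of the fresh habitat `E_{x,y} ∪ H`
has depth `≤ R₀` (`hdeep`) and `R₁ ≤ E − L'` is a uniform excess radius for entrance depth `R₀ + 1` and planar spread `50·rmax` (`hR₁`), then the
root is joined to a rim set `Rim` (fresh-habitat vertices of the habitat proper beyond depth `E − L'`) with probability `≤ η`.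
[cite: KozmaNitzan2024, §4 Lemma 12 (pp. 23–25), p. 31] -/
theorem real_rim_le_concSG [Countable V] (hlip : Lip G φ) (hstep : Steps G φ) (hΛ : WFS2 P Λ) {q : unitInterval} {δc : ℝ}
    {h : ProbeHistory V} {e : Site 2 × MDir}
    (hV : (⟨cellGeomSG G φ P t Λ, q, δc⟩ : KSchA V ℕ).Valid₂ G h e) {a' : ℕ}
    (ha' : a' ∈ (⟨cellGeomSG G φ P t Λ, q, δc⟩ : KSchA V ℕ).Γ.anchSet ((⟨cellGeomSG G φ P t Λ, q, δc⟩ : KSchA V ℕ).aOf₁ G h e) (tgt e))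
    {du : MDir} (hdu : du ∈ (⟨cellGeomSG G φ P t Λ, q, δc⟩ : KSchA V ℕ).onward G h (tgt e))
    {E : ℕ} (hEQ : Λ.rQ ((⟨cellGeomSG G φ P t Λ, q, δc⟩ : KSchA V ℕ).aOf₁ G h e) (tgt e) = E)
    (hB : Λ.rB ((⟨cellGeomSG G φ P t Λ, q, δc⟩ : KSchA V ℕ).aOf₁ G h e) e.1 e.2 ≤ E) (hρ : ∀ ℓ, Λ.ρ a' (tgt e) du ℓ ≤ E)
    {R₀ : ℕ}
    (hdeep : ∀ a ∈ (⟨cellGeomSG G φ P t Λ, q, δc⟩ : KSchA V ℕ).Vx G h,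
      ∀ b ∈ (⟨cellGeomSG G φ P t Λ, q, δc⟩ : KSchA V ℕ).Γ.Ewv ((⟨cellGeomSG G φ P t Λ, q, δc⟩ : KSchA V ℕ).aOf₁ G h e) e.1 e.2 ∪
        (faceDataSG G φ P t Λ).Hfull a' (tgt e) du,
      b ∉ (⟨cellGeomSG G φ P t Λ, q, δc⟩ : KSchA V ℕ).Vx G h → G.Adj a b → a ∈ graphBall G t R₀)
    {L' : ℕ} {η : ℝ} {R₁ : ℕ}
    (hR₁ : ∀ R', R₁ ≤ R' → ∀ (Rw : ℕ) (D' A' : Finset V), (∀ d ∈ D', d ∈ graphBall G t Rw) →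
      (∀ d ∈ D', ∀ d' ∈ D', φ d - φ d' ∈ box 2 (50 * P.rmax)) → A' ⊆ D' → (∀ a ∈ A', a ∈ graphBall G t (R₀ + 1)) →
        (bondPercolation G q).real (excess G t R' D' A') ≤ η)
    (hR : R₁ ≤ E - L') {Rim : Finset V} (hRim : Rim ⊆ habΩ G φ P t (Λ := Λ) q δc h e a' du)
    (hRimHab : Rim ⊆ (⟨cellGeomSG G φ P t Λ, q, δc⟩ : KSchA V ℕ).Γ.Q ((⟨cellGeomSG G φ P t Λ, q, δc⟩ : KSchA V ℕ).aOf₁ G h e) (tgt e) ∪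
      (⟨cellGeomSG G φ P t Λ, q, δc⟩ : KSchA V ℕ).Γ.Efar a' (tgt e) du)
    (hRimfar : ∀ t' ∈ Rim, t' ∉ graphBall G t (E - L')) :
    (prodBernoulli ((⟨cellGeomSG G φ P t Λ, q, δc⟩ : KSchA V ℕ).Wcor G (faceDataSG G φ P t Λ) h e
      ((⟨cellGeomSG G φ P t Λ, q, δc⟩ : KSchA V ℕ).aOf₁ G h e) a' du)).real (⋃ t' ∈ Rim, openConn t t') ≤ η := by
  set S : KSchA V ℕ := ⟨cellGeomSG G φ P t Λ, q, δc⟩ with hS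
  set FD := faceDataSG G φ P t Λ with hFD
  set α := S.aOf₁ G h e with hα
  have hL := levelGeomSG P t hΛ hlip (Λ := Λ)
  have hQ : QSepGeom G S.Γ := qSepGeomSG P t hlip (Λ := Λ)
  have hSt := stepsGeomSG P t hΛ hstep (Λ := Λ)
  -- the fresh world `Wld = E_{x,y} ∪ H` and its unexplored part `D`
  set Wld : Finset V := S.Γ.Ewv α e.1 e.2 ∪ FD.Hfull a' (tgt e) du with hWld
  have hWldΩ : habΩ G φ P t (Λ := Λ) q δc h e a' du = Wld := rfl
  set D : Finset V := Wld.filter (fun b => b ∉ S.Vx G h) with hDdef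
  -- (f1) the world lies in the graph ball of radius `E`
  have hWπ : ∀ b ∈ Wld, b ∈ graphBall G t E := fun b hb =>
    mem_graphBall_of_mem_Ewv_Hfull hB (le_of_eq hEQ) hρ hb
  -- (f2) planar footprints of the world lie in `cen y + Λ_{25·rmax}`
  have hQimg : P.Q (tgt e) ⊆ (box 2 (25 * P.rmax)).image (fun s => s + P.cen (tgt e)) :=
    (P.Q_subset_box_image _).trans (Finset.image_subset_image (box_mono 2 (by omega)))
  have hWpl : ∀ b ∈ Wld, φ b ∈ (box 2 (25 * P.rmax)).image (fun s => s + P.cen (tgt e)) := by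
    intro b hb
    rcases Finset.mem_union.1 hb with hb | hb
    · rw [CellGeom.Ewv] at hb
      rcases Finset.mem_union.1 hb with hb | hb
      · change b ∈ VWin G φ t (P.BtwN e.1 e.2) (Λ.rB α e.1 e.2) at hb
        exact P.BtwN_subset_box_image_tgt e.1 e.2 (φ_mem_of_mem_VWin hb)
      · change b ∈ VWin G φ t (P.Q (tgt e)) (Λ.rQ α (tgt e)) at hb
        exact hQimg (φ_mem_of_mem_VWin hb)
    · change b ∈ VStair G φ t (P.Hfull (tgt e) du) (prof P Λ a' (tgt e) du) at hb
      exact P.Hfull_subset_box_image _ _ (mem_of_mem_VStair hb).1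
  -- (f3) `Wld ⊆ Sx` and (f4) `Wld ⊆ Ucor`
  have hWSx : Wld ⊆ S.Sx G h e α a' du := by
    intro v hv
    rcases Finset.mem_union.1 hv with hv | hv
    · exact Finset.mem_union_left _ (Finset.mem_union_right _ hv)
    · rcases Finset.mem_union.1 (hSt.Hfull_subset _ _ _ _ ha' hv) with hv' | hv'
      · exact Finset.mem_union_left _ (Finset.mem_union_right _ (Finset.mem_union_right _ hv'))
      · exact Finset.mem_union_right _ hv'
  have hWU : Wld ⊆ S.Ucor G FD h e α a' du := by
    intro v hv
    rcases Finset.mem_union.1 hv with hv | hv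
    · exact Finset.mem_union_left _ (Finset.mem_union_right _ hv)
    · exact Finset.mem_union_right _ hv
  have hDW : D ⊆ Wld := Finset.filter_subset _ _
  have hDV : ∀ b ∈ D, b ∉ S.Vx G h := fun b hb => (Finset.mem_filter.1 hb).2
  -- vertices of `Ucor` outside `D` are explored
  have hUout : ∀ x ∈ S.Ucor G FD h e α a' du, x ∉ D → x ∈ S.Vx G h := by
    intro x hx hxD
    by_contra hxV
    rcases Finset.mem_union.1 hx with hx | hx
    · rcases Finset.mem_union.1 hx with hx | hx
      · exact hxV hx
      · exact hxD (Finset.mem_filter.2 ⟨Finset.mem_union_left _ hx, hxV⟩)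
    · exact hxD (Finset.mem_filter.2 ⟨Finset.mem_union_right _ hx, hxV⟩)
  -- the subbox property of `Wcor` on `D` in the window graph of the corridor world (no separation needed: `Ucor` IS the graph)
  have hWD : IsSubbox (winGraphIn G (S.Ucor G FD h e α a' du)) (S.Wcor G FD h e α a' du) q D :=
    KSchA.isSubbox_Wcor_graph (winGraphIn G (S.Ucor G FD h e α a' du)) (winGraphIn_le G _) hV.F_eq
      (hDW.trans hWSx) (hDW.trans hWU) (Finset.disjoint_left.2 fun b hb hbV => hDV b hb hbV)
      (fun u hu v hv huv => (winGraphIn_adj G).2 ⟨huv, hWU (hDW hu), hWU (hDW hv)⟩)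
      (fun v hv x hx _ hadj => (winGraphIn_adj G).2 ⟨hadj, hx, hWU (hDW hv)⟩)
  -- `Wcor` vanishes off the edges of `G`
  have hWG : ∀ x, x ∉ G.edgeSet → S.Wcor G FD h e α a' du x = 0 := by
    intro x hx
    by_cases hxU : x ∈ wireSet (↑(S.Ucor G FD h e α a' du) : Set V)
    · by_cases hxS : x ∈ wireSet (↑(S.Sx G h e α a' du) : Set V)
      · have hxF : x ∉ S.F G h := by
          intro hxF
          rw [hV.F_eq, mem_edgesIn_iff] at hxF
          exact hx hxF.1
        rw [KSchA.Wcor_apply_of_mem hxU hxS hxF, KNLevels.lattW_apply, if_neg hx]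
      · show restrW _ (restrW _ _) x = 0
        rw [restrW_apply_of_mem _ hxU, restrW_apply_of_not_mem _ hxS]
    · exact restrW_apply_of_not_mem _ hxU
  -- the root is explored, hence outside `D`
  have hroot : t ∉ D := fun hr => hDV _ hr (by have := hV.root_mem; exact this)
  -- the rim lies in `D`: inside the world (hypothesis) and fresh (separation of the habitat from the explored region)
  have hRimD : Rim ⊆ D := by
    intro t' ht
    refine Finset.mem_filter.2 ⟨hWldΩ ▸ hRim ht, fun htV => ?_⟩
    exact Finset.disjoint_left.1 (KSchA.disjoint_Vx_of_fresh hL hQ hV hdu hRimHab) ht htV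
  -- entrances are deep
  have hA : ∀ a b, a ∉ D → b ∈ D → G.Adj a b → S.Wcor G FD h e α a' du s(a, b) ≠ 0 → b ∈ graphBall G t (R₀ + 1) := by
    intro a b haD hbD hadj hW
    have haU : a ∈ S.Ucor G FD h e α a' du := by
      by_contra haU
      exact hW (restrW_apply_of_not_mem _ fun hw => haU (Finset.mem_coe.1 (mk_mem_wireSet_iff.1 hw).1))
    have haV : a ∈ S.Vx G h := hUout a haU haD
    exact BoxProdZ2.mem_graphBall_succ_of_adj G (hdeep a haV b (hDW hbD) (hDV b hbD) hadj) hadj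
  -- planar spread of `D`: differences of footprints lie in `Λ_{50·rmax}`
  have hDm : ∀ d ∈ D, ∀ d' ∈ D, φ d - φ d' ∈ box 2 (50 * P.rmax) := by
    intro d hd d' hd'
    obtain ⟨s, hs, hse⟩ := Finset.mem_image.1 (hWpl d (hDW hd))
    obtain ⟨s', hs', hse'⟩ := Finset.mem_image.1 (hWpl d' (hDW hd'))
    rw [← hse, ← hse', show s + P.cen (tgt e) - (s' + P.cen (tgt e)) = s - s' by abel]
    rw [mem_box] at hs hs' ⊢
    intro i
    have h1 := hs i
    have h2 := hs' i
    simp only [Pi.sub_apply]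
    push_cast
    omega
  exact real_rim_le_of_radius_In (Wt := S.Wcor G FD h e α a' du) (q := q) (D := D) hWD (hDW.trans hWU) hWG hroot
    hRimD hRimfar hA hR₁ hR (fun b hb => hWπ b (hDW hb)) hDm

end Skelφ

end Transplant

end Summit.CriticalPhenomena.PercolationContinuityZ3.Theorems
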